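/-
Literature/AlgebraicGeometry/ComplexMultiplication/CyclotomicDegenerateCMTypesTwoOddPrimesCount.lean — pub-hodgecm2 (COR-CM), KEPT
Literature lane lit-deligne-3 gen 68, file F68g.  THEOREMS ONLY (no `def`, no named fact, no `sorry`, no instance, no notation; D-0026
net debt 0).  HC_CM is NOT proved.
-/
import Literature.AlgebraicGeometry.ComplexMultiplication.CyclotomicDegenerateCMTypesThirtyOne
import Literature.AlgebraicGeometry.Pohlmann1968.CyclotomicResidueFamiliesHodgeClassCount
import HarnessLib

/-!
# Hazama's count on `ℚ(ζ_ℓ)`, `ℓ = 2pq + 1`: `dim Bᵖ(A) − dim Dᵖ(A) ≥ q(q − 1)` for the primitive `p`-dominated residue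
# types, and the `ℚ(ζ₃₁)` examples: `≥ 20` classes of codimension `3` on `A_S`, `≥ 6` of codimension `5` on `A_T`

Layer `Literature/AlgebraicGeometry/ComplexMultiplication` (namespace `…ComplexMultiplication.CyclotomicTwoOddPrimes`), sequel of
`CyclotomicDegenerateCMTypesTwoOddPrimes` (Hazama's Thm. 4.8 dressed on `ℚ(ζ_ℓ)`, residue sets `S ⊂ (ℤ/ℓ)ˣ`) and of
`CyclotomicDegenerateCMTypesThirtyOne` (the §6 examples); cell `pub-hodgecm2` (COR-CM), KEPT Literature lane `lit-deligne-3` gen 68,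
file F68g.  KERNEL ONLY (theorems; D-0014 ∕ D-0026 net debt `0`).  HC_CM is NOT proved here or anywhere in the lane.

## Mathematics

Frame `((ℤ/ℓ)ˣ; ρ = −1, τ, κ)` (`|(ℤ/ℓ)ˣ| = 2pq`, `τ` of order `p`, `κ` of order `q`), `S ⊂ (ℤ/ℓ)ˣ` a CM residue set, `Φ_S` its CM type
of `ℚ(ζ_ℓ)`.  Hazama's kernel sets `Δ(y₁, y₂) = {τˣκ^{y₁}} ∪ {ρτˣκ^{y₂}}` (`y₁, y₂ ∈ ℤ/q`; tree `CyclicCMType.hazamaSet`) are the weight-`p`,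
height-one elements behind the proper Hodge cycles of codimension `p` of a `p`-DOMINATED type (constant row sums `#{x : τˣκʸ ∈ S}`):
balanced for `S` (`isBalanced_hazamaSet`), of `2p` elements, not `ρ`-symmetric for `y₁ ≠ y₂`.  They are PAIRWISE DISTINCT
(`hazamaSet_injective_units`: the even half determines `y₁`, the odd half `y₂`), so their residue images form a family of `q(q − 1)` balanced,
non-symmetric residue sets of cardinality `2p`, and the lane's residue count (F68f `Cyclotomic.card_le_finrank_sub_of_residues`, White's count
Gordon 9.2.2 for primitive types) gives, for `S` PRIMITIVE (no unit `≠ 1` stabilises `S`) and `p`-dominated: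

  **`dim Bᵖ(A) − dim Dᵖ(A) ≥ q(q − 1)` on EVERY abelian variety `A` of type `(ℚ(ζ_ℓ); Φ_S)`**
  (`mul_sub_one_le_finrank_sub_of_hasConstantRows`; `q`-dominated: `≥ p(p − 1)` in codimension `q`).

This is HAZAMA'S OWN COUNT read as a lower bound: for `S ∈ S_p − S_1` the proper Hodge cycles of weight `p` correspond to the `{0, ±1}`-vectors
of weight `p` in the lattice `V_{2q} ∩ ℤ[ℤ/2n] = ⟨w_k^{(2q)} : 1 ≤ k ≤ q − 1⟩_ℤ` (Prop. 3.2, §5), which are `±w_k^{(2q)}` (`2(q−1)` of them) and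
`w_k^{(2q)} − w_l^{(2q)}`, `k ≠ l` (`(q−1)(q−2)` of them): `q(q−1)` in all.  THE `ℚ(ζ₃₁)` EXAMPLES (§6, `p = 3`, `q = 5`, `τ = 5`, `κ = 2`):
for the recipe set `S = hazamaS₃₁ ∈ S₃ − S₁` EVERY abelian variety `A_S` (a simple `15`-fold) has **`dim B³(A_S) − dim D³(A_S) ≥ 5·4 = 20`**
(`twenty_le_finrank_sub_hazamaS`), and for `T = hazamaT₃₁ ∈ S₅ − S₁`: **`dim B⁵(A_T) − dim D⁵(A_T) ≥ 3·2 = 6`** (`six_le_finrank_sub_hazamaT`);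
such varieties exist (`exists_realisation_twenty_le`).

THE PRINT.  F. Hazama [Hazama2003CyclicCM] Prop. 3.2 (pp. 586–587), Thm. 4.8 (iv)–(v) (p. 594), §5 (pp. 596–597), §6 (pp. 597–598: «the
abelian variety `A_S` associated to it is absolutely simple and `3`-dominated … a member of the set of … `480` of `3`-dominated absolutely
simple abelian varieties with complex multiplication by `K₃₁`»); B. B. Gordon [Gordon1999HodgeAVSurvey] 9.2.2.  The number `q(q−1)` is the
lane's reading of Prop. 3.2 ∕ §5 (recorded in `Pohlmann1968/MixedDifferenceCubeExponentFamilies` and `…/DegenerateCMTypesCyclicCMFieldTwoOddPrimes`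
§5); equality is NOT claimed.

## Contents

* §1 (private) `hazamaSet_injective_units` (any finite commutative frame).
* §2 **`mul_sub_one_le_finrank_sub_of_hasConstantRows`**, `mul_sub_one_le_finrank_sub_of_hasConstantCols`,
  `mul_sub_one_le_finrank_sub_of_not_isNondegenerate`.
* §3 `ℚ(ζ₃₁)`: **`twenty_le_finrank_sub_hazamaS`**, **`six_le_finrank_sub_hazamaT`**, `exists_realisation_twenty_le`.

HONEST REGISTER.  Glue over F68f and the gen-18 cyclotomic files; lower bounds only; no algebraicity.  HC_CM is NOT proved and not used.

## References

* [Hazama2003CyclicCM] F. Hazama, J. Math. Sci. Univ. Tokyo 10 (2003) 581–598: Prop. 3.2, Thm. 4.8 (iv)–(v), §5, §6.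
* [Gordon1999HodgeAVSurvey] B. B. Gordon, *A survey of the Hodge conjecture for abelian varieties*, 9.2.2, §9.4.2.
* [Pohlmann1968] H. Pohlmann, Ann. of Math. 88 (1968), Thm. 1 and §3.
* [Shimura1998] G. Shimura, *Abelian Varieties with Complex Multiplication and Modular Functions*, §6.2 Thm. 3, §8.2 Prop. 26.

## Provenance

Cell `pub-hodgecm2` (COR-CM), KEPT Literature lane `lit-deligne-3` gen 68 (claim HAZAMA-COUNT-CYCLOTOMIC; count-neutral), file F68g; neighbours
cited by name: `CyclotomicDegenerateCMTypesTwoOddPrimes` (frame, `balanced_image_val_of_isBalanced`, `image_val_subset_unitResidues`,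
`finrank_div_two_eq`, `two_lt_of_cyclicFrame`, `separating_of_forall_not_isStableUnder`, `not_isNondegenerate_iff_of_primitive`),
`CyclotomicDegenerateCMTypesThirtyOne` (`frame31`, `hazamaS₃₁`, `hazamaT₃₁`, their certificates), F68f `CyclotomicResidueFamiliesHodgeClassCount`
(`card_le_finrank_sub_of_residues`), `NumberTheory/…/DegenerateCMTypesCyclicTwoOddPrimes` (`hazamaSet`, `isBalanced_hazamaSet`, `card_hazamaSet`,
`exists_mem_hazamaSet_rho_mul_not_mem`).  Theorems only; net Literature debt 0.
-/

set_option autoImplicit false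

noncomputable section

open scoped BigOperators NumberField
open CategoryTheory NumberField

namespace Literature.AlgebraicGeometry.ComplexMultiplication

namespace CyclotomicTwoOddPrimes

open Literature.NumberTheory.ComplexMultiplication
open Literature.NumberTheory.ComplexMultiplication.CyclicCMType
open Literature.AlgebraicGeometry.Motives (AbelianVariety CMType)
open Literature.AlgebraicGeometry.HodgeTheory
open Literature.AlgebraicGeometry.Pohlmann1968 Literature.AlgebraicGeometry.Pohlmann1968.Cyclotomic
open Literature.AlgebraicGeometry.ComplexMultiplication.CyclotomicCMTypeResidueSets
open Literature.AlgebraicGeometry.VanGeemen1994 (hodgeClassSpan)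
open Literature.Barriers.HodgeConjecture (divisorClassesSpan)

/-! ## §1 The kernel sets are pairwise distinct (any finite commutative frame) -/

section Group

variable {G : Type} [CommGroup G] [Fintype G] [DecidableEq G] {p q : ℕ} {ρ τ κ : G}

/-- **`(y₁, y₂) ↦ Δ(y₁, y₂)` is injective**: the even half `{τˣκ^{y₁}}` determines `y₁`, the odd half `{ρτˣκ^{y₂}}` determines `y₂`
(coordinates `τˣκʸ` of the odd part; `ρ` is not in the odd part).  (The `K`-dressed twin is
`Pohlmann1968.CyclicTwoOddPrimes.hazamaSet_injective`.) [cite: Hazama2003CyclicCM, Prop. 3.2 (3.2) and §5 (5.2)] -/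
private theorem hazamaSet_injective_units (hF : CyclicFrame p q ρ τ κ) :
    haveI : NeZero p := ⟨hF.prime_left.ne_zero⟩
    Function.Injective fun y : ZMod q × ZMod q => hazamaSet p ρ τ κ y.1 y.2 := by
  haveI : NeZero p := ⟨hF.prime_left.ne_zero⟩
  rintro ⟨y₁, y₂⟩ ⟨y₁', y₂'⟩ h
  simp only at h
  have h1 : τ ^ (0 : ZMod p).val * κ ^ y₁.val ∈ hazamaSet p ρ τ κ y₁' y₂' := by
    rw [← h]
    unfold hazamaSet
    exact Finset.mem_union_left _ (Finset.mem_image.2 ⟨0, Finset.mem_univ _, rfl⟩)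
  have h2 : ρ * (τ ^ (0 : ZMod p).val * κ ^ y₂.val) ∈ hazamaSet p ρ τ κ y₁' y₂' := by
    rw [← h]
    unfold hazamaSet
    exact Finset.mem_union_right _ (Finset.mem_image.2 ⟨0, Finset.mem_univ _, rfl⟩)
  unfold hazamaSet at h1 h2
  rw [Finset.mem_union] at h1 h2
  have hy₁ : y₁ = y₁' := by
    rcases h1 with h1 | h1
    · obtain ⟨x, -, he⟩ := Finset.mem_image.1 h1
      exact ((Prod.ext_iff.1 (hF.pow_mul_pow_injective (a₁ := (x, y₁')) (a₂ := (0, y₁)) he)).2).symm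
    · obtain ⟨x, -, he⟩ := Finset.mem_image.1 h1
      exact (hF.pow_mul_pow_ne_rho_mul _ _ _ _ he.symm).elim
  have hy₂ : y₂ = y₂' := by
    rcases h2 with h2 | h2
    · obtain ⟨x, -, he⟩ := Finset.mem_image.1 h2
      exact (hF.pow_mul_pow_ne_rho_mul _ _ _ _ he).elim
    · obtain ⟨x, -, he⟩ := Finset.mem_image.1 h2
      exact ((Prod.ext_iff.1 (hF.pow_mul_pow_injective (a₁ := (x, y₂')) (a₂ := (0, y₂)) (mul_left_cancel he))).2).symm
  rw [hy₁, hy₂]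

end Group

/-! ## §2 `dim Bᵖ(A) − dim Dᵖ(A) ≥ q(q − 1)` for the primitive `p`-dominated residue types of `ℚ(ζ_ℓ)` -/

section Field

variable {ℓ : ℕ} [NeZero ℓ] {p q : ℕ} {τ κ : (ZMod ℓ)ˣ}
variable {L : Type} [Field L] [NumberField L] [IsCyclotomicExtension {ℓ} ℚ L]
variable {S : Finset (ZMod ℓ)} {hS : ∀ c : ZMod ℓ, c.val.Coprime ℓ → (c ∈ S ↔ -c ∉ S)}
variable {A : AbelianVariety ℂ} {ι : 𝓞 L →+* End A} {θ : L →+* Module.End ℂ (complexBetti A.X 1)}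

/-- **HAZAMA'S COUNT ON `ℚ(ζ_ℓ)`: `dim Bᵖ(A) − dim Dᵖ(A) ≥ q(q − 1)`.**  If `S` is PRIMITIVE (no unit `≠ 1` stabilises `{u : u mod ℓ ∈ S}`) and
`p`-DOMINATED (constant row counts), then on EVERY abelian variety `A` of CM type `(ℚ(ζ_ℓ); Φ_S)` — a simple `pq`-fold — the `q(q − 1)` kernel
sets `Δ(y₁, y₂)`, `y₁ ≠ y₂`, read as residue sets, are pairwise distinct, balanced, of cardinality `2p` and not `(−1)`-symmetric, so
`dim Bᵖ(A) − dim Dᵖ(A) ≥ q(q − 1)` (White's count on residues, F68f).  In print: the weight-`p` proper Hodge cycles of `A_S`, `S ∈ S_p − S_1`,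
are indexed by the `q(q−1)` vectors `±w_k^{(2q)}`, `w_k^{(2q)} − w_l^{(2q)}` of Prop. 3.2.
[cite: Hazama2003CyclicCM, Prop. 3.2, Thm. 4.8 (iv), §5 (p. 596–597)] [cite: Gordon1999HodgeAVSurvey, 9.2.2] [cite: Pohlmann1968, Thm. 1 and §3] -/
theorem mul_sub_one_le_finrank_sub_of_hasConstantRows (hF : CyclicFrame p q (-1 : (ZMod ℓ)ˣ) τ κ)
    (hprim : ∀ u : (ZMod ℓ)ˣ, u ≠ 1 →
      ¬ IsStableUnder (Finset.univ.filter fun v : (ZMod ℓ)ˣ => ((v : (ZMod ℓ)ˣ) : ZMod ℓ) ∈ S) u)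
    (hr : haveI : NeZero p := ⟨hF.prime_left.ne_zero⟩;
      HasConstantRows p q (Finset.univ.filter fun v : (ZMod ℓ)ˣ => ((v : (ZMod ℓ)ˣ) : ZMod ℓ) ∈ S) τ κ)
    (hA : IsCMTypeRealisation (cmTypeOfResidues (L := L) S hS) A ι θ) :
    q * (q - 1) ≤ Module.finrank ℂ ↥(hodgeClassSpan (p * q) A.X p) -
      Module.finrank ℂ ↥(divisorClassesSpan A.X (p * q) p) := by
  haveI : NeZero p := ⟨hF.prime_left.ne_zero⟩
  haveI : NeZero q := ⟨hF.prime_right.ne_zero⟩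
  have h := CyclotomicFermatCMType.isCMTypeWith_unitsFilter ℓ hS
  -- the family of residue images of the kernel sets `Δ(y₁, y₂)`, `y₁ ≠ y₂`
  have hPinj : Function.Injective fun y : ZMod q × ZMod q =>
      (hazamaSet p (-1 : (ZMod ℓ)ˣ) τ κ y.1 y.2).image fun u : (ZMod ℓ)ˣ => (u : ZMod ℓ) := fun y y' hyy =>
    hazamaSet_injective_units hF (Finset.image_injective (fun _ _ h => Units.ext h) hyy)
  have hcount := card_le_finrank_sub_of_residues (hS := hS) (unitResidues ℓ) (coprime_iff_mem_unitResidues ℓ)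
    (two_lt_of_cyclicFrame hF) (separating_of_forall_not_isStableUnder hprim) (m := p)
    ((Finset.univ : Finset (ZMod q)).offDiag.image fun y : ZMod q × ZMod q =>
      (hazamaSet p (-1 : (ZMod ℓ)ˣ) τ κ y.1 y.2).image fun u : (ZMod ℓ)ˣ => (u : ZMod ℓ)) ?_ hA
  · rw [finrank_div_two_eq L hF, Finset.card_image_of_injective _ hPinj, Finset.offDiag_card, Finset.card_univ, ZMod.card]
      at hcount
    rwa [Nat.mul_sub_one]
  · intro P hP
    obtain ⟨y, hy, rfl⟩ := Finset.mem_image.1 hP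
    have hy12 : y.1 ≠ y.2 := (Finset.mem_offDiag.1 hy).2.2
    refine ⟨image_val_subset_unitResidues _, balanced_image_val_of_isBalanced (S := S) (isBalanced_hazamaSet hF h hr y.1 y.2),
      ?_, ?_⟩
    · obtain ⟨d, hd, hnd⟩ := exists_mem_hazamaSet_rho_mul_not_mem hF hy12
      refine ⟨(d : ZMod ℓ), Finset.mem_image_of_mem _ hd, fun hc => hnd ?_⟩
      obtain ⟨d', hd', hdd'⟩ := Finset.mem_image.1 hc
      have : d' = -1 * d := Units.ext (by rw [hdd', Units.val_mul, Units.val_neg, Units.val_one, neg_one_mul])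
      rw [← this]
      exact hd'
    · rw [Finset.card_image_of_injective _ fun _ _ h => Units.ext h, card_hazamaSet hF]

/-- **The `q`-dominated case: `dim B^q(A) − dim D^q(A) ≥ p(p − 1)`** (frame with `p, τ` and `q, κ` exchanged).
[cite: Hazama2003CyclicCM, Prop. 3.2, Thm. 4.8 (v), §5] [cite: Gordon1999HodgeAVSurvey, 9.2.2] -/
theorem mul_sub_one_le_finrank_sub_of_hasConstantCols (hF : CyclicFrame p q (-1 : (ZMod ℓ)ˣ) τ κ)
    (hprim : ∀ u : (ZMod ℓ)ˣ, u ≠ 1 →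
      ¬ IsStableUnder (Finset.univ.filter fun v : (ZMod ℓ)ˣ => ((v : (ZMod ℓ)ˣ) : ZMod ℓ) ∈ S) u)
    (hc : haveI : NeZero q := ⟨hF.prime_right.ne_zero⟩;
      HasConstantRows q p (Finset.univ.filter fun v : (ZMod ℓ)ˣ => ((v : (ZMod ℓ)ˣ) : ZMod ℓ) ∈ S) κ τ)
    (hA : IsCMTypeRealisation (cmTypeOfResidues (L := L) S hS) A ι θ) :
    p * (p - 1) ≤ Module.finrank ℂ ↥(hodgeClassSpan (p * q) A.X q) -
      Module.finrank ℂ ↥(divisorClassesSpan A.X (p * q) q) := by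
  rw [mul_comm p q]
  exact mul_sub_one_le_finrank_sub_of_hasConstantRows hF.swap hprim hc hA

/-- **PRIMITIVE AND DEGENERATE ⟹ `q(q−1)` independent nondivisorial `(p,p)`-classes or `p(p−1)` independent nondivisorial `(q,q)`-classes
on `A` itself** (Thm. 4.8 (ii)–(v): a primitive degenerate residue type is `p`- or `q`-dominated).
[cite: Hazama2003CyclicCM, Thm. 4.8 (ii)–(v), Prop. 3.2, §5 and Rem. 4.10] [cite: Gordon1999HodgeAVSurvey, 9.2.2] -/
theorem mul_sub_one_le_finrank_sub_of_not_isNondegenerate (hF : CyclicFrame p q (-1 : (ZMod ℓ)ˣ) τ κ)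
    (hprim : ∀ u : (ZMod ℓ)ˣ, u ≠ 1 →
      ¬ IsStableUnder (Finset.univ.filter fun v : (ZMod ℓ)ˣ => ((v : (ZMod ℓ)ˣ) : ZMod ℓ) ∈ S) u)
    (hdeg : ¬ IsNondegenerate (cmTypeOfResidues (L := L) S hS))
    (hA : IsCMTypeRealisation (cmTypeOfResidues (L := L) S hS) A ι θ) :
    q * (q - 1) ≤ Module.finrank ℂ ↥(hodgeClassSpan (p * q) A.X p) -
        Module.finrank ℂ ↥(divisorClassesSpan A.X (p * q) p) ∨
      p * (p - 1) ≤ Module.finrank ℂ ↥(hodgeClassSpan (p * q) A.X q) -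
        Module.finrank ℂ ↥(divisorClassesSpan A.X (p * q) q) := by
  rcases (not_isNondegenerate_iff_of_primitive L hF hS hprim).1 hdeg with ⟨hr, -⟩ | ⟨hc, -⟩
  · exact Or.inl (mul_sub_one_le_finrank_sub_of_hasConstantRows hF hprim hr hA)
  · exact Or.inr (mul_sub_one_le_finrank_sub_of_hasConstantCols hF hprim hc hA)

end Field

/-! ## §3 Hazama's `ℚ(ζ₃₁)` examples: `dim B³(A_S) − dim D³(A_S) ≥ 20`, `dim B⁵(A_T) − dim D⁵(A_T) ≥ 6` -/

section ThirtyOne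

open CyclotomicThirtyOne

variable (L : Type) [Field L] [NumberField L] [IsCyclotomicExtension {31} ℚ L]
variable {A : AbelianVariety ℂ} {ι : 𝓞 L →+* End A} {θ : L →+* Module.End ℂ (complexBetti A.X 1)}

/-- **`dim B³(A_S) − dim D³(A_S) ≥ 20 = 5·4`** for EVERY abelian variety `A_S` of type `(ℚ(ζ₃₁); Φ_S)`, `S = hazamaS₃₁ ∈ S₃ − S₁` (§6: simple,
`3`-dominated `15`-folds; frame `τ = 5`, `κ = 2`, `p = 3`, `q = 5`): twenty pairwise distinct kernel sets `Δ(y₁, y₂) ⊂ (ℤ/31)ˣ`, `y₁ ≠ y₂ ∈ ℤ/5`,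
each carrying a rational `(3,3)`-class line outside `D³(A_S) ⊗ ℂ`. [cite: Hazama2003CyclicCM, §6 (p. 597), Prop. 3.2, Thm. 4.8 (iv) and §5]
[cite: Gordon1999HodgeAVSurvey, 9.2.2] -/
theorem twenty_le_finrank_sub_hazamaS
    (hA : IsCMTypeRealisation (cmTypeOfResidues (L := L) hazamaS₃₁ isCMResidueSet_hazamaS.cm) A ι θ) :
    20 ≤ Module.finrank ℂ ↥(hodgeClassSpan 15 A.X 3) - Module.finrank ℂ ↥(divisorClassesSpan A.X 15 3) :=
  mul_sub_one_le_finrank_sub_of_hasConstantRows frame31 (hasTrivialStabilizer_iff.1 hasTrivialStabilizer_hazamaS)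
    hasConstantRows_hazamaS hA

/-- **`dim B⁵(A_T) − dim D⁵(A_T) ≥ 6 = 3·2`** for EVERY abelian variety `A_T` of type `(ℚ(ζ₃₁); Φ_T)`, `T = hazamaT₃₁ ∈ S₅ − S₁` (§6: simple,
`5`-dominated `15`-folds): six pairwise distinct kernel sets of `10` units each, carrying rational `(5,5)`-class lines outside `D⁵(A_T) ⊗ ℂ`.
[cite: Hazama2003CyclicCM, §6 (p. 598), Prop. 3.2, Thm. 4.8 (v) and §5] [cite: Gordon1999HodgeAVSurvey, 9.2.2] -/
theorem six_le_finrank_sub_hazamaT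
    (hA : IsCMTypeRealisation (cmTypeOfResidues (L := L) hazamaT₃₁ isCMResidueSet_hazamaT.cm) A ι θ) :
    6 ≤ Module.finrank ℂ ↥(hodgeClassSpan 15 A.X 5) - Module.finrank ℂ ↥(divisorClassesSpan A.X 15 5) :=
  mul_sub_one_le_finrank_sub_of_hasConstantCols frame31 (hasTrivialStabilizer_iff.1 hasTrivialStabilizer_hazamaT)
    hasConstantCols_hazamaT hA

/-- **Such `15`-folds exist**: a SIMPLE abelian variety of type `(ℚ(ζ₃₁); Φ_S)`, `dim = 15`, with `dim B³ − dim D³ ≥ 20` (Shimura §6.2 Thm. 3 via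
the tree's `exists_realisation_hazamaS`). [cite: Hazama2003CyclicCM, §6 (p. 597)] [cite: Shimura1998, §6.2 Theorem 3] -/
theorem exists_realisation_twenty_le :
    ∃ (B : AbelianVariety ℂ) (ι' : 𝓞 L →+* End B) (θ' : L →+* Module.End ℂ (complexBetti B.X 1)),
      IsCMTypeRealisation (cmTypeOfResidues (L := L) hazamaS₃₁ isCMResidueSet_hazamaS.cm) B ι' θ' ∧
        B.IsSimple ∧ B.dim = 15 ∧
          20 ≤ Module.finrank ℂ ↥(hodgeClassSpan 15 B.X 3) - Module.finrank ℂ ↥(divisorClassesSpan B.X 15 3) := by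
  obtain ⟨B, ι', θ', hB, hsimple, hdim, -⟩ := exists_realisation_hazamaS L
  exact ⟨B, ι', θ', hB, hsimple, hdim, twenty_le_finrank_sub_hazamaS L hB⟩

end ThirtyOne

end CyclotomicTwoOddPrimes

end Literature.AlgebraicGeometry.ComplexMultiplication
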